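import Mathlib
import Summits.CriticalPhenomena.Ising3DConformalLimit.Theses.BallSpecification
import Summits.CriticalPhenomena.Ising3DConformalLimit.Theses.MarkovRigidity
import Summits.CriticalPhenomena.Ising3DConformalLimit.Theorems.BallSpecificationBallSpecifiedFieldLimitProperGermKernels
import Summits.CriticalPhenomena.Ising3DConformalLimit.Theorems.BallSpecificationBallSpecifiedFieldLimitFieldLimitOfEuclidean
import Summits.CriticalPhenomena.Ising3DConformalLimit.Theorems.BallSpecificationBallSpecifiedFieldLimitSplitAtSpheres
import Summits.CriticalPhenomena.Ising3DConformalLimit.Theorems.BallSpecificationBallSpecifiedFieldLimitOneSidedGermOfMI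
import Literature.Probability.LatticeModels.ScalingLimit3D
import HarnessLib

/-!
# `BallSpecification.BallSpecifiedFieldLimit` (item stmt-CriticalPhenomena-11247) — the crux from S03 ∧ MI

THEOREM-ONLY file (lead c3 of the line `registered`, `Cruxes/BallSpecifiedFieldLimit/Lines/birth.lean`).
The crux `BallSpecifiedFieldLimit` (`∃ ρ Δ S L μ γ, C1 ∧ … ∧ C17`: the scaling limit of the critical
3-D Ising spin field carried by a law `μ` on `𝓢'(ℝ³)` and specified on balls by proper,
exterior-measurable, germ-Markov kernels) is reduced to the conjunction of two EXISTING registered open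
statements: the pointwise conjecture crit-ising.S03 `CritIsing3DEuclideanLimit` and the Markov-inheritance
statement `Theses.MarkovRigidity.MarkovInheritance` (item stmt-CriticalPhenomena-11236). Conversely the
crux projects onto S03. All intermediate nodes are landed theorems of this directory:
`stub_fieldLimitOfEuclidean` (S03 ⇒ field limit C1–C12 with moment data), `stub_splitAtSpheres`,
`stub_oneSidedGermOfMI`, `stub_properGermKernels`.

References: Duminil-Copin ICM 2022 §8.4; Glimm–Jaffe 1987 §6.1; Rozanov 1982 Ch. 2; Röckner 1986 §1.
No definitions are introduced.
-/

noncomputable section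

namespace Summit.CriticalPhenomena.Ising3DConformalLimit.Theorems

open MeasureTheory Filter

/-- For two points, non-coincidence follows from `x 0 ≠ x 1`. [folklore] -/
theorem ballSpecifiedFieldLimit_mem_nonCoincident_two {x : Fin 2 → EuclideanSpace ℝ (Fin 3)} (hx : x 0 ≠ x 1) :
    x ∈ Literature.Probability.LatticeModels.NonCoincident 3 2 := by
  rw [Literature.Probability.LatticeModels.mem_nonCoincident]
  intro i j hij
  fin_cases i <;> fin_cases j
  · rfl
  · exact absurd hij hx
  · exact absurd hij.symm hx
  · rfl

/-- The two-point function from the moment densities: `E_μ[ω(f) ω(g)] = ∫ S₂(x) f(x₀) g(x₁) dx`.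
[folklore] -/
theorem ballSpecifiedFieldLimit_integral_eval_mul_eval
    {μ : MeasureTheory.Measure (Literature.MathematicalPhysics.QuantumLattice.FieldConfig (EuclideanSpace ℝ (Fin 3)))}
    {S : Literature.Probability.LatticeModels.CorrFamily 3}
    (h : Literature.MathematicalPhysics.QuantumLattice.HasMomentDensity μ S)
    (f g : SchwartzMap (EuclideanSpace ℝ (Fin 3)) ℝ) :
    ∫ ω, ω f * ω g ∂μ = ∫ x : Fin 2 → EuclideanSpace ℝ (Fin 3), S 2 x * (f (x 0) * g (x 1)) := by
  have h2 := h 2 ![f, g]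
  simp only [Literature.MathematicalPhysics.QuantumLattice.moment, Fin.prod_univ_two,
    Matrix.cons_val_zero, Matrix.cons_val_one] at h2
  exact h2

/-- **Crux `BallSpecifiedFieldLimit` from the two EXISTING open statements** — the registered
conjecture crit-ising.S03 `Literature.Probability.LatticeModels.CritIsing3DEuclideanLimit` (pointwise
Euclidean-invariant, scale-covariant, non-degenerate scaling limit of `criticalCorr 3`; Duminil-Copin
ICM 2022 §8.4, open) and the statement of item stmt-CriticalPhenomena-11236
`Summit.CriticalPhenomena.Ising3DConformalLimit.Theses.MarkovRigidity.MarkovInheritance` (McKean's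
germ-Markov property of every law carrying a pointwise critical limit as moment densities; crux rank 2 of
route MarkovRigidity, open). CONDITIONAL RESULT (both hypotheses are open problems): the field limit with
its moment data is `stub_fieldLimitOfEuclidean` (p155926); MI applied to it gives McKean's property on
every ball; `stub_splitAtSpheres` (p156027) and `stub_oneSidedGermOfMI` (p156110) turn it into the
one-sided a.e. germ-Markov property; `stub_properGermKernels` (p146798) manufactures the kernels with
C13–C17. Hence the crux carries no open mathematics of its own beyond S03 ∧ MI. [folklore] -/
theorem ballSpecifiedFieldLimit_of_critIsing3DEuclideanLimit_of_markovInheritance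
    (hE : Literature.Probability.LatticeModels.CritIsing3DEuclideanLimit)
    (hMI : Summit.CriticalPhenomena.Ising3DConformalLimit.Theses.MarkovRigidity.MarkovInheritance) :
    Summit.CriticalPhenomena.Ising3DConformalLimit.Theses.BallSpecification.BallSpecifiedFieldLimit := by
  -- GLUE (LANDED, p155926): the S03 witness gives the field limit with its moment data
  obtain ⟨ρ, Δ, S, L, μ, ⟨hρ, hΔ, hlim, hnorm, hnd, heuc, hsc, hL, hlaw, hmom, heucl, hscl⟩,
    hprob, hallm, hexp, hSm, hK⟩ :=
    stub_fieldLimitOfEuclidean hE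
  haveI := hprob
  -- MI (item 11236) for this `μ`, on balls
  have hMIμ := hMI ρ Δ S μ hρ hlim hnorm hnd heuc.1 hsc hprob hallm hexp (fun n f => hmom n f)
    (fun A => ⨆ (f : SchwartzMap (EuclideanSpace ℝ (Fin 3)) ℝ) (_ : tsupport ⇑f ⊆ A),
      MeasurableSpace.comap (fun ω : Literature.MathematicalPhysics.QuantumLattice.FieldConfig (EuclideanSpace ℝ (Fin 3)) => ω f) (borel ℝ)) rfl
  have hballs : ∀ (c : EuclideanSpace ℝ (Fin 3)) (r : ℝ), 0 < r → ∀ F : Literature.MathematicalPhysics.QuantumLattice.FieldConfig (EuclideanSpace ℝ (Fin 3)) → ℝ,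
        Measurable[⨅ (ε : ℝ) (_ : 0 < ε), Literature.MathematicalPhysics.QuantumLattice.extEvents (Metric.thickening ε (Metric.ball c r))] F →
        (∃ C : ℝ, ∀ ω, |F ω| ≤ C) →
        MeasureTheory.condExp ((⨅ (ε : ℝ) (_ : 0 < ε), Literature.MathematicalPhysics.QuantumLattice.extEvents (Metric.thickening ε (Metric.ball c r)ᶜ)) ⊔
            ⨅ (ε : ℝ) (_ : 0 < ε), Literature.MathematicalPhysics.QuantumLattice.extEvents (Metric.thickening ε (frontier (Metric.ball c r)))) μ F
          =ᵐ[μ] MeasureTheory.condExp (⨅ (ε : ℝ) (_ : 0 < ε), Literature.MathematicalPhysics.QuantumLattice.extEvents (Metric.thickening ε (frontier (Metric.ball c r)))) μ F :=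
    fun c r _ F hF hbd => hMIμ (Metric.ball c r) (Or.inl ⟨c, r, rfl⟩) F hF hbd
  -- the two-point data for B1
  obtain ⟨C, a, ha0, ha3, hCa⟩ := hK
  -- B1 (LANDED, p156027): test functions split at every sphere modulo `μ`
  have hsplit := stub_splitAtSpheres μ hprob
    (fun f => by exact_mod_cast hallm 2 f)
    ⟨S 2, C, a, hSm 2, ha0, ha3, fun x hx => hCa x (ballSpecifiedFieldLimit_mem_nonCoincident_two hx),
      ballSpecifiedFieldLimit_integral_eval_mul_eval hmom⟩
  -- B2 (LANDED, p156110): the one-sided a.e. germ-Markov property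
  have hmarkov := stub_oneSidedGermOfMI μ hprob
    hsplit hballs
  -- S3 (LANDED, p146798): kernel version with C13–C17
  obtain ⟨γ, h13, h14, h15, h16, h17⟩ :=
    stub_properGermKernels μ hprob hmarkov
  exact ⟨ρ, Δ, S, L, μ, γ, hρ, hΔ, hlim, hnorm, hnd, heuc, hsc, hL, hlaw, hmom, heucl, hscl,
    h13, h14, h15, h16, h17⟩

/-- **The crux contains the registered open conjecture crit-ising.S03** (projection onto conjuncts
C1, C2, C3, C5, C6, C7); with `stub_fieldLimitOfEuclidean` the kernel-free conjuncts C1–C12 of the crux are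
EQUIVALENT to `CritIsing3DEuclideanLimit`. [folklore] -/
theorem critIsing3DEuclideanLimit_of_ballSpecifiedFieldLimit
    (h : Summit.CriticalPhenomena.Ising3DConformalLimit.Theses.BallSpecification.BallSpecifiedFieldLimit) :
    Literature.Probability.LatticeModels.CritIsing3DEuclideanLimit := by
  obtain ⟨ρ, Δ, S, L, μ, γ, hρ, hΔ, hlim, -, hnd, hE, hsc, -⟩ := h
  exact ⟨ρ, Δ, S, hρ, hΔ, hlim, hnd, hE, hsc⟩

end Summit.CriticalPhenomena.Ising3DConformalLimit.Theorems

end
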